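import Mathlib
import HarnessLib

/-!
# Crux `PolyMobiusTail` (stmt-Parity-0870), line `eta-free-multilinear-window`:
# helper for `stub_pair_corner` — the divisor switch as an exact identity

Aux stub `stub_pair_corner_identity` (head theorem) with its bookkeeping lemmas (`PairCorner.*`):
for linear forms `P(n) = q₀ n + a₀`, `R(n) = q₁ n + a₁` positive from `n₁` on,

  `∑_{n₁ ≤ n ≤ x} ∑_{d ∣ P(n)} ∑_{b ∣ R(n)} 𝟙[x^{1-η} < d b ≤ x^{1+θ}, d ≤ x^σ] μ(d) log d μ(b) log b`
  `= ∑_{m ≤ M} ∑_{d ≤ x^σ} μ(d) log d ∑_{b} μ(b) log b`,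

the inner sum over the `b ≤ R(x)` in the window for which some `n ∈ [n₁, x]` has `d ∣ P(n)` and
`b m = R(n)`, `M = ⌊R(x) x^{σ+η-1}⌋` (insert the cofactor `m = R(n)/b`, which is `≤ M` because
`b > x^{1-σ-η}` in the window; truncate `d` at `x^σ`; swap; `R` is injective).  Elementary.
-/

open scoped BigOperators
open Filter Finset Asymptotics

namespace Summit.Parity.BatemanHorn.Theorems.PolyMobiusTail.EtaFreeWindow

namespace PairCorner

/-- Inserting the cofactor: if `b ∣ K`, `K ≥ 1`, and the weight vanishes unless `K / b ≤ M`, then the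
weight equals its sum against `𝟙[b m = K]` over `1 ≤ m ≤ M` (only `m = K / b` contributes). [folklore] -/
theorem ite_eq_sum_Icc_ite_mul_eq {b K M : ℕ} (hb : 0 < b) (hK : 0 < K) (hbK : b ∣ K)
    (W : Prop) [Decidable W] (V : ℝ) (hM : W → K / b ≤ M) :
    (if W then V else 0) = ∑ m ∈ Icc 1 M, if b * m = K then (if W then V else 0) else 0 := by
  by_cases hW : W
  · obtain ⟨m₀, hm₀⟩ := hbK
    have hm₀' : K / b = m₀ := by rw [hm₀, Nat.mul_div_cancel_left m₀ hb]
    have hm₀1 : 1 ≤ m₀ := by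
      rcases Nat.eq_zero_or_pos m₀ with h | h
      · rw [h, mul_zero] at hm₀; omega
      · exact h
    have hmem : m₀ ∈ Icc 1 M := mem_Icc.2 ⟨hm₀1, hm₀' ▸ hM hW⟩
    have heq : ∀ m, (b * m = K) ↔ m = m₀ := by
      intro m
      rw [hm₀]
      constructor
      · intro h; exact Nat.eq_of_mul_eq_mul_left hb h
      · rintro rfl; rfl
    simp_rw [heq]
    rw [Finset.sum_ite_eq' (Icc 1 M) m₀, if_pos hmem]
  · simp [hW]

/-- The cofactor is short: in the window `x^{1-η} < d b`, `d ≤ x^σ`, a value `K ≤ R` factored as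
`K = b · (K/b)` has `K / b ≤ R x^{σ+η-1}`. [folklore] -/
theorem div_le_floor_of_window {x d b K : ℕ} {σ η : ℝ} {R : ℝ} (hx : 0 < x)
    (hW1 : (x : ℝ) ^ (1 - η) < (d : ℝ) * (b : ℝ)) (hW3 : (d : ℝ) ≤ (x : ℝ) ^ σ)
    (hR : 0 < R) (hK : (K : ℝ) ≤ R) : K / b ≤ ⌊R * (x : ℝ) ^ (σ + η - 1)⌋₊ := by
  have hx0 : (0 : ℝ) < x := by exact_mod_cast hx
  have hxs : 0 < (x : ℝ) ^ σ := Real.rpow_pos_of_pos hx0 σ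
  have hb0 : (0 : ℝ) < b := by
    have hb0' : (0 : ℝ) ≤ b := Nat.cast_nonneg b
    rcases hb0'.lt_or_eq with h | h
    · exact h
    · rw [← h, mul_zero] at hW1
      exact absurd hW1 (not_lt.2 (Real.rpow_nonneg hx0.le _))
  -- `x^{1-σ-η} < b`
  have hb : (x : ℝ) ^ (1 - σ - η) < b := by
    have h1 : (x : ℝ) ^ (1 - η) < (x : ℝ) ^ σ * b :=
      lt_of_lt_of_le hW1 (mul_le_mul_of_nonneg_right hW3 hb0.le)
    have h2 : (x : ℝ) ^ (1 - σ - η) = (x : ℝ) ^ (1 - η) / (x : ℝ) ^ σ := by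
      rw [← Real.rpow_sub hx0]; ring_nf
    rw [h2, div_lt_iff₀ hxs]
    linarith [mul_comm ((x : ℝ) ^ σ) (b : ℝ)]
  rw [Nat.le_floor_iff (by positivity)]
  have h3 : ((K / b : ℕ) : ℝ) ≤ (K : ℝ) / b := Nat.cast_div_le
  have h4 : (K : ℝ) / b ≤ R / b := div_le_div_of_nonneg_right hK hb0.le
  have h5 : R / b ≤ R * (x : ℝ) ^ (σ + η - 1) := by
    rw [div_le_iff₀ hb0]
    have h6 : R ≤ R * ((x : ℝ) ^ (σ + η - 1) * (x : ℝ) ^ (1 - σ - η)) := by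
      rw [← Real.rpow_add hx0]; ring_nf; rw [Real.rpow_zero, mul_one]
    calc R ≤ R * ((x : ℝ) ^ (σ + η - 1) * (x : ℝ) ^ (1 - σ - η)) := h6
      _ = R * (x : ℝ) ^ (σ + η - 1) * (x : ℝ) ^ (1 - σ - η) := by ring
      _ ≤ R * (x : ℝ) ^ (σ + η - 1) * b :=
          mul_le_mul_of_nonneg_left hb.le (by positivity)
  linarith

/-- Truncating the divisor: a sum over the divisors of `K ≠ 0` whose terms vanish beyond `D` is the
sum over `1 ≤ d ≤ D` against `𝟙[d ∣ K]`. [folklore] -/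
theorem sum_divisors_eq_sum_Icc_ite (K D : ℕ) (hK : K ≠ 0) (G : ℕ → ℝ)
    (hG : ∀ d ∈ K.divisors, D < d → G d = 0) :
    ∑ d ∈ K.divisors, G d = ∑ d ∈ Icc 1 D, if d ∣ K then G d else 0 := by
  rw [← sum_filter]
  rw [← Finset.sum_filter_of_ne (s := K.divisors) (p := fun d => d ≤ D)
    (fun d hd hne => by by_contra h; exact hne (hG d hd (not_le.1 h)))]
  refine sum_congr ?_ fun _ _ => rfl
  ext d
  simp only [mem_filter, Nat.mem_divisors, mem_Icc]
  constructor
  · rintro ⟨⟨hdK, -⟩, hdD⟩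
    exact ⟨⟨Nat.pos_of_dvd_of_pos hdK (Nat.pos_of_ne_zero hK), hdD⟩, hdK⟩
  · rintro ⟨⟨-, hdD⟩, hdK⟩
    exact ⟨⟨hdK, hK⟩, hdD⟩

/-- Extending the complementary divisor to a fixed range: against `𝟙[b m = K]` the divisors of `K`
may be replaced by `1 ≤ b ≤ B` for any `B ≥ K`. [folklore] -/
theorem sum_divisors_ite_eq_sum_Icc_ite (K B m : ℕ) (hK : K ≠ 0) (hKB : K ≤ B) (A : Prop)
    [Decidable A] (F : ℕ → ℝ) :
    ∑ b ∈ K.divisors, (if A ∧ b * m = K then F b else 0) =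
      ∑ b ∈ Icc 1 B, (if A ∧ b * m = K then F b else 0) := by
  refine Finset.sum_subset (fun b hb => ?_) (fun b _ hb' => ?_)
  · rw [Nat.mem_divisors] at hb
    rw [mem_Icc]
    exact ⟨Nat.pos_of_dvd_of_pos hb.1 (Nat.pos_of_ne_zero hK), (Nat.le_of_dvd (Nat.pos_of_ne_zero hK) hb.1).trans hKB⟩
  · rw [if_neg]
    rintro ⟨-, h⟩
    exact hb' (Nat.mem_divisors.2 ⟨⟨m, h.symm⟩, hK⟩)

/-- Summing the indicator `𝟙[d ∣ P(n), b m = R(n)]` over `n`: since `R` is injective, at most one `n`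
contributes. [folklore] -/
theorem sum_Icc_ite_dvd_and_mul_eq {q₀ q₁ : ℕ} (hq₁ : 0 < q₁) {a₀ a₁ : ℤ} {n₁ : ℕ}
    (hR : 0 < (q₁ : ℤ) * n₁ + a₁) (x d b m : ℕ) (W : Prop) [Decidable W] (V : ℝ) :
    ∑ n ∈ Icc n₁ x, (if d ∣ ((q₀ : ℤ) * n + a₀).toNat ∧ b * m = ((q₁ : ℤ) * n + a₁).toNat then
        (if W then V else 0) else 0) =
      if W ∧ ∃ n ∈ Icc n₁ x, d ∣ ((q₀ : ℤ) * n + a₀).toNat ∧ b * m = ((q₁ : ℤ) * n + a₁).toNat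
        then V else 0 := by
  have hRpos : ∀ n : ℕ, n₁ ≤ n → 0 < (q₁ : ℤ) * n + a₁ := by
    intro n hn
    have : (q₁ : ℤ) * n₁ ≤ (q₁ : ℤ) * n :=
      mul_le_mul_of_nonneg_left (by exact_mod_cast hn) (by positivity)
    linarith
  by_cases hex : ∃ n ∈ Icc n₁ x, d ∣ ((q₀ : ℤ) * n + a₀).toNat ∧ b * m = ((q₁ : ℤ) * n + a₁).toNat
  · obtain ⟨n₀, hn₀, hdn₀, hbn₀⟩ := hex
    rw [Finset.sum_eq_single_of_mem n₀ hn₀]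
    · rw [if_pos ⟨hdn₀, hbn₀⟩]
      by_cases hW : W
      · rw [if_pos hW, if_pos ⟨hW, n₀, hn₀, hdn₀, hbn₀⟩]
      · rw [if_neg hW, if_neg (fun h => hW h.1)]
    · intro n hn hne
      rw [if_neg]
      rintro ⟨-, hbn⟩
      apply hne
      have h1 : ((q₁ : ℤ) * n + a₁).toNat = ((q₁ : ℤ) * n₀ + a₁).toNat := hbn.symm.trans hbn₀
      have h2 : (q₁ : ℤ) * n + a₁ = (q₁ : ℤ) * n₀ + a₁ := by
        have h1' : ((((q₁ : ℤ) * n + a₁).toNat : ℕ) : ℤ) = ((((q₁ : ℤ) * n₀ + a₁).toNat : ℕ) : ℤ) := by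
          rw [h1]
        rwa [Int.toNat_of_nonneg (hRpos n (mem_Icc.1 hn).1).le,
          Int.toNat_of_nonneg (hRpos n₀ (mem_Icc.1 hn₀).1).le] at h1'
      have h3 : (q₁ : ℤ) * n = (q₁ : ℤ) * n₀ := by linarith
      have hq₁z : (q₁ : ℤ) ≠ 0 := by exact_mod_cast hq₁.ne'
      exact_mod_cast mul_left_cancel₀ hq₁z h3
  · have hrhs : (if W ∧ ∃ n ∈ Icc n₁ x, d ∣ ((q₀ : ℤ) * n + a₀).toNat ∧
        b * m = ((q₁ : ℤ) * n + a₁).toNat then V else 0) = 0 := if_neg fun h => hex h.2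
    rw [hrhs]
    exact Finset.sum_eq_zero fun n hn => if_neg fun h => hex ⟨n, hn, h⟩

end PairCorner

/-- **Aux stub `stub_pair_corner_identity` (helper for `stub_pair_corner`, line eta-free-multilinear-window):
the divisor switch for the corner, as an exact identity.**  For the pair of linear forms
`P(n) = q₀ n + a₀`, `R(n) = q₁ n + a₁` (`q₁ ≥ 1`, both positive from `n₁ ≥ 1` on) and `x ≥ n₁`,
the one-sided corner sum `∑_{n₁ ≤ n ≤ x} ∑_{d ∣ P(n)} ∑_{b ∣ R(n)} 𝟙[x^{1-η} < d b ≤ x^{1+θ}, d ≤ x^σ]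
μ(d) log d · μ(b) log b` equals `∑_{m ≤ M} ∑_{d ≤ x^σ} μ(d) log d ∑_b μ(b) log b`, the `b`-sum running over
the `b ≤ R(x)` in the window for which some `n ∈ [n₁, x]` has `d ∣ P(n)` and `b m = R(n)`; here
`M = ⌊R(x) x^{σ+η-1}⌋` because `b > x^{1-σ-η}` in the window.  (Insert `m = R(n)/b`, truncate `d`,
swap the sums, and use that `R` is injective.) [folklore] -/
theorem stub_pair_corner_identity : ∀ (q₀ q₁ : ℕ) (a₀ a₁ : ℤ), 0 < q₁ → ∀ (n₁ : ℕ), 1 ≤ n₁ →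
    0 < (q₀ : ℤ) * n₁ + a₀ → 0 < (q₁ : ℤ) * n₁ + a₁ → ∀ (σ η θ : ℝ) (x : ℕ), n₁ ≤ x →
    ∑ n ∈ Finset.Icc n₁ x, ∑ d ∈ (((q₀ : ℤ) * n + a₀).toNat).divisors, ∑ b ∈ (((q₁ : ℤ) * n + a₁).toNat).divisors,
        (if ((x : ℝ) ^ (1 - η) < (d : ℝ) * (b : ℝ) ∧ (d : ℝ) * (b : ℝ) ≤ (x : ℝ) ^ (1 + θ) ∧ (d : ℝ) ≤ (x : ℝ) ^ σ) then (ArithmeticFunction.moebius d : ℝ) * Real.log d * ((ArithmeticFunction.moebius b : ℝ) * Real.log b) else 0) =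
      ∑ m ∈ Finset.Icc 1 ⌊((q₁ : ℝ) * x + a₁) * (x : ℝ) ^ (σ + η - 1)⌋₊, ∑ d ∈ Finset.Icc 1 ⌊(x : ℝ) ^ σ⌋₊,
        (ArithmeticFunction.moebius d : ℝ) * Real.log d *
          ∑ b ∈ (Finset.Icc 1 ((q₁ : ℤ) * x + a₁).toNat).filter (fun b : ℕ => ((x : ℝ) ^ (1 - η) < (d : ℝ) * (b : ℝ) ∧ (d : ℝ) * (b : ℝ) ≤ (x : ℝ) ^ (1 + θ) ∧ (d : ℝ) ≤ (x : ℝ) ^ σ) ∧ ∃ n ∈ Finset.Icc n₁ x, d ∣ ((q₀ : ℤ) * n + a₀).toNat ∧ b * m = ((q₁ : ℤ) * n + a₁).toNat),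
            (ArithmeticFunction.moebius b : ℝ) * Real.log b := by
  intro q₀ q₁ a₀ a₁ hq₁ n₁ hn₁ hP hR σ η θ x hx
  have hx0 : 0 < x := lt_of_lt_of_le hn₁ hx
  have hPpos : ∀ n : ℕ, n₁ ≤ n → 0 < (q₀ : ℤ) * n + a₀ := by
    intro n hn
    have : (q₀ : ℤ) * n₁ ≤ (q₀ : ℤ) * n :=
      mul_le_mul_of_nonneg_left (by exact_mod_cast hn) (by positivity)
    linarith
  have hRpos : ∀ n : ℕ, n₁ ≤ n → 0 < (q₁ : ℤ) * n + a₁ := by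
    intro n hn
    have : (q₁ : ℤ) * n₁ ≤ (q₁ : ℤ) * n :=
      mul_le_mul_of_nonneg_left (by exact_mod_cast hn) (by positivity)
    linarith
  have hRle : ∀ n : ℕ, n ≤ x → ((q₁ : ℤ) * n + a₁).toNat ≤ ((q₁ : ℤ) * x + a₁).toNat := by
    intro n hn
    have : (q₁ : ℤ) * n ≤ (q₁ : ℤ) * x :=
      mul_le_mul_of_nonneg_left (by exact_mod_cast hn) (by positivity)
    exact Int.toNat_le_toNat (by linarith)
  have hRx : 0 < (q₁ : ℤ) * x + a₁ := hRpos x hx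
  have hRxr : (0 : ℝ) < (q₁ : ℝ) * x + a₁ := by exact_mod_cast hRx
  have hRvr : ∀ n : ℕ, n₁ ≤ n → n ≤ x → ((((q₁ : ℤ) * n + a₁).toNat : ℕ) : ℝ) ≤ (q₁ : ℝ) * x + a₁ := by
    intro n hn1 hnx
    have h1 : ((((q₁ : ℤ) * n + a₁).toNat : ℕ) : ℤ) ≤ (q₁ : ℤ) * x + a₁ := by
      rw [Int.toNat_of_nonneg (hRpos n hn1).le]
      have : (q₁ : ℤ) * n ≤ (q₁ : ℤ) * x :=
        mul_le_mul_of_nonneg_left (by exact_mod_cast hnx) (by positivity)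
      linarith
    exact_mod_cast h1
  -- Step A: insert the cofactor `m` and truncate `d`
  have hA : ∀ n ∈ Finset.Icc n₁ x,
      ∑ d ∈ (((q₀ : ℤ) * n + a₀).toNat).divisors, ∑ b ∈ (((q₁ : ℤ) * n + a₁).toNat).divisors, (if ((x : ℝ) ^ (1 - η) < (d : ℝ) * (b : ℝ) ∧ (d : ℝ) * (b : ℝ) ≤ (x : ℝ) ^ (1 + θ) ∧ (d : ℝ) ≤ (x : ℝ) ^ σ) then (ArithmeticFunction.moebius d : ℝ) * Real.log d * ((ArithmeticFunction.moebius b : ℝ) * Real.log b) else 0) =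
      ∑ d ∈ Finset.Icc 1 ⌊(x : ℝ) ^ σ⌋₊, ∑ b ∈ (((q₁ : ℤ) * n + a₁).toNat).divisors, ∑ m ∈ Finset.Icc 1 ⌊((q₁ : ℝ) * x + a₁) * (x : ℝ) ^ (σ + η - 1)⌋₊,
        (if d ∣ ((q₀ : ℤ) * n + a₀).toNat ∧ b * m = ((q₁ : ℤ) * n + a₁).toNat then (if ((x : ℝ) ^ (1 - η) < (d : ℝ) * (b : ℝ) ∧ (d : ℝ) * (b : ℝ) ≤ (x : ℝ) ^ (1 + θ) ∧ (d : ℝ) ≤ (x : ℝ) ^ σ) then (ArithmeticFunction.moebius d : ℝ) * Real.log d * ((ArithmeticFunction.moebius b : ℝ) * Real.log b) else 0) else 0) := by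
    intro n hn
    obtain ⟨hn1, hnx⟩ := Finset.mem_Icc.1 hn
    have hPn := hPpos n hn1
    have hRn := hRpos n hn1
    have hPn0 : ((q₀ : ℤ) * n + a₀).toNat ≠ 0 := fun h => by rw [Int.toNat_eq_zero] at h; linarith
    have hRn0 : ((q₁ : ℤ) * n + a₁).toNat ≠ 0 := fun h => by rw [Int.toNat_eq_zero] at h; linarith
    rw [PairCorner.sum_divisors_eq_sum_Icc_ite _ ⌊(x : ℝ) ^ σ⌋₊ hPn0
      (fun d => ∑ b ∈ (((q₁ : ℤ) * n + a₁).toNat).divisors, (if ((x : ℝ) ^ (1 - η) < (d : ℝ) * (b : ℝ) ∧ (d : ℝ) * (b : ℝ) ≤ (x : ℝ) ^ (1 + θ) ∧ (d : ℝ) ≤ (x : ℝ) ^ σ) then (ArithmeticFunction.moebius d : ℝ) * Real.log d * ((ArithmeticFunction.moebius b : ℝ) * Real.log b) else 0)) ?_]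
    · refine Finset.sum_congr rfl fun d _ => ?_
      by_cases hdP : d ∣ ((q₀ : ℤ) * n + a₀).toNat
      · rw [if_pos hdP]
        refine Finset.sum_congr rfl fun b hb => ?_
        obtain ⟨hbK, -⟩ := Nat.mem_divisors.1 hb
        have hb0 : 0 < b := Nat.pos_of_dvd_of_pos hbK (Nat.pos_of_ne_zero hRn0)
        refine (PairCorner.ite_eq_sum_Icc_ite_mul_eq (M := ⌊((q₁ : ℝ) * x + a₁) * (x : ℝ) ^ (σ + η - 1)⌋₊) hb0
          (Nat.pos_of_ne_zero hRn0) hbK ((x : ℝ) ^ (1 - η) < (d : ℝ) * (b : ℝ) ∧ (d : ℝ) * (b : ℝ) ≤ (x : ℝ) ^ (1 + θ) ∧ (d : ℝ) ≤ (x : ℝ) ^ σ)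
          ((ArithmeticFunction.moebius d : ℝ) * Real.log d * ((ArithmeticFunction.moebius b : ℝ) * Real.log b))
          (fun hW => PairCorner.div_le_floor_of_window hx0 hW.1 hW.2.2 hRxr (hRvr n hn1 hnx))).trans ?_
        refine Finset.sum_congr rfl fun m _ => ?_
        by_cases hbm : b * m = ((q₁ : ℤ) * n + a₁).toNat
        · rw [if_pos hbm]; exact (if_pos ⟨hdP, hbm⟩).symm
        · rw [if_neg hbm]; exact (if_neg (fun h => hbm h.2)).symm
      · rw [if_neg hdP]
        symm
        exact Finset.sum_eq_zero fun b _ => Finset.sum_eq_zero fun m _ => if_neg fun h => hdP h.1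
    · intro d _ hDd
      refine Finset.sum_eq_zero fun b _ => if_neg ?_
      rintro ⟨-, -, h3⟩
      have := (Nat.floor_lt (Real.rpow_nonneg (Nat.cast_nonneg x) σ)).1 hDd
      linarith
  rw [Finset.sum_congr rfl hA]
  -- Step B: bring `m` and `d` outside
  have hB : ∑ n ∈ Finset.Icc n₁ x, ∑ d ∈ Finset.Icc 1 ⌊(x : ℝ) ^ σ⌋₊, ∑ b ∈ (((q₁ : ℤ) * n + a₁).toNat).divisors,
      ∑ m ∈ Finset.Icc 1 ⌊((q₁ : ℝ) * x + a₁) * (x : ℝ) ^ (σ + η - 1)⌋₊, (if d ∣ ((q₀ : ℤ) * n + a₀).toNat ∧ b * m = ((q₁ : ℤ) * n + a₁).toNat then (if ((x : ℝ) ^ (1 - η) < (d : ℝ) * (b : ℝ) ∧ (d : ℝ) * (b : ℝ) ≤ (x : ℝ) ^ (1 + θ) ∧ (d : ℝ) ≤ (x : ℝ) ^ σ) then (ArithmeticFunction.moebius d : ℝ) * Real.log d * ((ArithmeticFunction.moebius b : ℝ) * Real.log b) else 0) else 0) =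
      ∑ m ∈ Finset.Icc 1 ⌊((q₁ : ℝ) * x + a₁) * (x : ℝ) ^ (σ + η - 1)⌋₊, ∑ d ∈ Finset.Icc 1 ⌊(x : ℝ) ^ σ⌋₊, ∑ n ∈ Finset.Icc n₁ x,
        ∑ b ∈ (((q₁ : ℤ) * n + a₁).toNat).divisors, (if d ∣ ((q₀ : ℤ) * n + a₀).toNat ∧ b * m = ((q₁ : ℤ) * n + a₁).toNat then (if ((x : ℝ) ^ (1 - η) < (d : ℝ) * (b : ℝ) ∧ (d : ℝ) * (b : ℝ) ≤ (x : ℝ) ^ (1 + θ) ∧ (d : ℝ) ≤ (x : ℝ) ^ σ) then (ArithmeticFunction.moebius d : ℝ) * Real.log d * ((ArithmeticFunction.moebius b : ℝ) * Real.log b) else 0) else 0) := by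
    calc _ = ∑ n ∈ Finset.Icc n₁ x, ∑ d ∈ Finset.Icc 1 ⌊(x : ℝ) ^ σ⌋₊, ∑ m ∈ Finset.Icc 1 ⌊((q₁ : ℝ) * x + a₁) * (x : ℝ) ^ (σ + η - 1)⌋₊,
          ∑ b ∈ (((q₁ : ℤ) * n + a₁).toNat).divisors, (if d ∣ ((q₀ : ℤ) * n + a₀).toNat ∧ b * m = ((q₁ : ℤ) * n + a₁).toNat then (if ((x : ℝ) ^ (1 - η) < (d : ℝ) * (b : ℝ) ∧ (d : ℝ) * (b : ℝ) ≤ (x : ℝ) ^ (1 + θ) ∧ (d : ℝ) ≤ (x : ℝ) ^ σ) then (ArithmeticFunction.moebius d : ℝ) * Real.log d * ((ArithmeticFunction.moebius b : ℝ) * Real.log b) else 0) else 0) :=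
          Finset.sum_congr rfl fun n _ => Finset.sum_congr rfl fun d _ => Finset.sum_comm
      _ = ∑ n ∈ Finset.Icc n₁ x, ∑ m ∈ Finset.Icc 1 ⌊((q₁ : ℝ) * x + a₁) * (x : ℝ) ^ (σ + η - 1)⌋₊, ∑ d ∈ Finset.Icc 1 ⌊(x : ℝ) ^ σ⌋₊,
          ∑ b ∈ (((q₁ : ℤ) * n + a₁).toNat).divisors, (if d ∣ ((q₀ : ℤ) * n + a₀).toNat ∧ b * m = ((q₁ : ℤ) * n + a₁).toNat then (if ((x : ℝ) ^ (1 - η) < (d : ℝ) * (b : ℝ) ∧ (d : ℝ) * (b : ℝ) ≤ (x : ℝ) ^ (1 + θ) ∧ (d : ℝ) ≤ (x : ℝ) ^ σ) then (ArithmeticFunction.moebius d : ℝ) * Real.log d * ((ArithmeticFunction.moebius b : ℝ) * Real.log b) else 0) else 0) :=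
          Finset.sum_congr rfl fun n _ => Finset.sum_comm
      _ = ∑ m ∈ Finset.Icc 1 ⌊((q₁ : ℝ) * x + a₁) * (x : ℝ) ^ (σ + η - 1)⌋₊, ∑ n ∈ Finset.Icc n₁ x, ∑ d ∈ Finset.Icc 1 ⌊(x : ℝ) ^ σ⌋₊,
          ∑ b ∈ (((q₁ : ℤ) * n + a₁).toNat).divisors, (if d ∣ ((q₀ : ℤ) * n + a₀).toNat ∧ b * m = ((q₁ : ℤ) * n + a₁).toNat then (if ((x : ℝ) ^ (1 - η) < (d : ℝ) * (b : ℝ) ∧ (d : ℝ) * (b : ℝ) ≤ (x : ℝ) ^ (1 + θ) ∧ (d : ℝ) ≤ (x : ℝ) ^ σ) then (ArithmeticFunction.moebius d : ℝ) * Real.log d * ((ArithmeticFunction.moebius b : ℝ) * Real.log b) else 0) else 0) := Finset.sum_comm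
      _ = _ := Finset.sum_congr rfl fun m _ => Finset.sum_comm
  rw [hB]
  refine Finset.sum_congr rfl fun m _ => Finset.sum_congr rfl fun d _ => ?_
  -- Step C: for fixed `m, d`, the `n`-sum collapses
  calc ∑ n ∈ Finset.Icc n₁ x, ∑ b ∈ (((q₁ : ℤ) * n + a₁).toNat).divisors, (if d ∣ ((q₀ : ℤ) * n + a₀).toNat ∧ b * m = ((q₁ : ℤ) * n + a₁).toNat then (if ((x : ℝ) ^ (1 - η) < (d : ℝ) * (b : ℝ) ∧ (d : ℝ) * (b : ℝ) ≤ (x : ℝ) ^ (1 + θ) ∧ (d : ℝ) ≤ (x : ℝ) ^ σ) then (ArithmeticFunction.moebius d : ℝ) * Real.log d * ((ArithmeticFunction.moebius b : ℝ) * Real.log b) else 0) else 0)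
      = ∑ n ∈ Finset.Icc n₁ x, ∑ b ∈ Finset.Icc 1 ((q₁ : ℤ) * x + a₁).toNat, (if d ∣ ((q₀ : ℤ) * n + a₀).toNat ∧ b * m = ((q₁ : ℤ) * n + a₁).toNat then (if ((x : ℝ) ^ (1 - η) < (d : ℝ) * (b : ℝ) ∧ (d : ℝ) * (b : ℝ) ≤ (x : ℝ) ^ (1 + θ) ∧ (d : ℝ) ≤ (x : ℝ) ^ σ) then (ArithmeticFunction.moebius d : ℝ) * Real.log d * ((ArithmeticFunction.moebius b : ℝ) * Real.log b) else 0) else 0) := by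
        refine Finset.sum_congr rfl fun n hn => ?_
        obtain ⟨hn1, hnx⟩ := Finset.mem_Icc.1 hn
        have hRn0 : ((q₁ : ℤ) * n + a₁).toNat ≠ 0 := fun h => by
          rw [Int.toNat_eq_zero] at h; linarith [hRpos n hn1]
        exact PairCorner.sum_divisors_ite_eq_sum_Icc_ite _ _ m hRn0 (hRle n hnx) _ _
    _ = ∑ b ∈ Finset.Icc 1 ((q₁ : ℤ) * x + a₁).toNat, ∑ n ∈ Finset.Icc n₁ x, (if d ∣ ((q₀ : ℤ) * n + a₀).toNat ∧ b * m = ((q₁ : ℤ) * n + a₁).toNat then (if ((x : ℝ) ^ (1 - η) < (d : ℝ) * (b : ℝ) ∧ (d : ℝ) * (b : ℝ) ≤ (x : ℝ) ^ (1 + θ) ∧ (d : ℝ) ≤ (x : ℝ) ^ σ) then (ArithmeticFunction.moebius d : ℝ) * Real.log d * ((ArithmeticFunction.moebius b : ℝ) * Real.log b) else 0) else 0) := Finset.sum_comm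
    _ = ∑ b ∈ Finset.Icc 1 ((q₁ : ℤ) * x + a₁).toNat,
          (if ((x : ℝ) ^ (1 - η) < (d : ℝ) * (b : ℝ) ∧ (d : ℝ) * (b : ℝ) ≤ (x : ℝ) ^ (1 + θ) ∧ (d : ℝ) ≤ (x : ℝ) ^ σ) ∧ ∃ n ∈ Finset.Icc n₁ x, d ∣ ((q₀ : ℤ) * n + a₀).toNat ∧ b * m = ((q₁ : ℤ) * n + a₁).toNat then (ArithmeticFunction.moebius d : ℝ) * Real.log d * ((ArithmeticFunction.moebius b : ℝ) * Real.log b) else 0) :=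
        Finset.sum_congr rfl fun b _ => PairCorner.sum_Icc_ite_dvd_and_mul_eq hq₁ hR x d b m _ _
    _ = _ := by
        rw [Finset.sum_filter, Finset.mul_sum]
        refine Finset.sum_congr rfl fun b _ => ?_
        split_ifs <;> ring

end Summit.Parity.BatemanHorn.Theorems.PolyMobiusTail.EtaFreeWindow
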